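import Mathlib
import Summits.RiemannHypothesis.RiemannHypothesis.Theorems.WeilFarFloorCoshSplitRH
import Literature.NumberTheory.LFunctions.WeilBochnerRepresentationRH
import Literature.NumberTheory.LFunctions.WeilMellinBounds
import Literature.NumberTheory.LFunctions.WeilMellinInversion
import HarnessLib

/-!
# Under RH: the zero energy of the prime-shift anatomy as a positive quadratic form (polarization)

Helper file (`--supports stmt-RiemannHypothesis-0098`, lead-track anchor: Weil-positivity window ladder, format-C far bound),
pure proofs.  Seat rh-explicit-weil-1 gen12 (memo `run/shared/lean/pub/rh-explicit/rh-explicit-weil-1/FORMAT-K3.md` §13.5): stage 2b of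
C-XIII″ under RH.  The cosh split of `WeilFarFloorCoshSplitRH` DROPS the zero energy `Z(g) = ∫ ‖ĝ(½+it)‖² dν(t)` (`ν` the height measure of
the zeros, Literature `WeilBochner.zetaZeroHeightMeasure`); to recover the zero energy of the cosh component one needs `Z` as a QUADRATIC FORM:

* `zeroEnergy_eq_of_RH` : under RH, for a real Weil test `g` on `[−b, b]`,
  `Z(g) = 2(∫g·cosh(·/2))² − 2(∫g·sinh(·/2))² − (2I₀ + log 4π + γ)∫g² + ∫₀^∞ρ_∞(t)·∫(g(x+t) − g(x))²dx dt − Q_b(g)` (Bombieri's Dirichlet form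
  + the Bochner form of the explicit formula; the exact anatomy solved for the zero energy, with REAL increments);
* `zeroEnergy_smul_add` : `Z(c·f + r) = c²Z(f) + 2c·X(f,r) + Z(r)` with the cross energy `X(f,r) = ∫ Re(f̂(½+it)·conj r̂(½+it)) dν`,
  for real Weil tests `f, r` and real `c` (RH gives the integrability);
* `zeroEnergy_add_sub_zeroEnergy_sub` : `Z(f+r) − Z(f−r) = 4X(f,r)`;  `zeroEnergy_nonneg` : `Z(r) ≥ 0`;
* `zeroEnergy_smul_add_ge` : **`Z(c·f + r) ≥ c²Z(f) + (c/2)(Z(f+r) − Z(f−r))`** — the lower bound that keeps the cosh component's zero energy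
  and turns the cross term into anatomy differences of `f ± r` (FORMAT-K3 §13.5, stage 3).
Standard axioms only; RH enters as Mathlib's `RiemannHypothesis`.
-/

set_option linter.dupNamespace false
set_option autoImplicit false

noncomputable section

open MeasureTheory Set Filter Complex
open scoped Real Topology ArithmeticFunction.vonMangoldt

namespace Summit.RiemannHypothesis.RiemannHypothesis.Theorems.WeilFormatC

namespace FloorCoshSplit

open Literature.NumberTheory.LFunctions

variable {b : ℝ}

/-! ## §1 The exact anatomy, solved for the zero energy -/

/-- **UNDER RH, the zero energy of a real Weil test on `[−b, b]`**:
`∫‖ĝ(½+it)‖²dν = 2(∫g·cosh(·/2))² − 2(∫g·sinh(·/2))² − (2I₀ + log 4π + γ)∫g² + ∫_{(0,∞)}ρ_∞(t)∫(g(x+t) − g(x))²dx dt − Q_b(g)`. -/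
theorem zeroEnergy_eq_of_RH (hRH : RiemannHypothesis) {g : ℝ → ℝ} (hg : IsWeilTest fun x ↦ (g x : ℂ))
    (hsub : tsupport (fun x ↦ (g x : ℂ)) ⊆ Icc (-b) b) :
    ∫ t : ℝ, ‖weilMellin (fun x ↦ (g x : ℂ)) (1 / 2 + t * I)‖ ^ 2 ∂WeilBochner.zetaZeroHeightMeasure
      = 2 * (∫ t, g t * Real.cosh (t / 2)) ^ 2 - 2 * (∫ t, g t * Real.sinh (t / 2)) ^ 2
        - (2 * (∫ t in Ioi (0 : ℝ), (Real.exp (t / 2) - 1) / (2 * Real.sinh t))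
            + (Real.log (4 * π) + Real.eulerMascheroniConstant)) * (∫ x, g x ^ 2)
        + (∫ t in Ioi (0 : ℝ), weilArchDensity t * ∫ x, (g (x + t) - g x) ^ 2)
        - primeShiftForm b g := by
  obtain ⟨huc, hum, ⟨Cu, hCu⟩, hus0⟩ := weilTest_admissible hg hsub
  have hZ := (WeilBochner.weilQuadratic_eq_integral_of_riemannHypothesis hRH hg).2
  have hre : (weilQuadratic fun x ↦ (g x : ℂ)).re
      = ∫ t : ℝ, ‖weilMellin (fun x ↦ (g x : ℂ)) (1 / 2 + t * I)‖ ^ 2 ∂WeilBochner.zetaZeroHeightMeasure := by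
    rw [hZ, Complex.ofReal_re]
  rw [weilQuadratic_re_eq_weilPoleForm_add_weilDirichletEnergy_sub hg hsub] at hre
  -- the pole form and the norm
  have hpole : weilPoleForm (fun x ↦ (g x : ℂ))
      = 2 * (∫ t, g t * Real.cosh (t / 2)) ^ 2 - 2 * (∫ t, g t * Real.sinh (t / 2)) ^ 2 := by
    have hC' : (∫ t, (g t : ℂ) * (Real.cosh (t / 2) : ℂ)) = ((∫ t, g t * Real.cosh (t / 2) : ℝ) : ℂ) := by
      rw [← integral_complex_ofReal]; exact integral_congr_ae (ae_of_all _ fun t ↦ by push_cast; ring)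
    have hS' : (∫ t, (g t : ℂ) * (Real.sinh (t / 2) : ℂ)) = ((∫ t, g t * Real.sinh (t / 2) : ℝ) : ℂ) := by
      rw [← integral_complex_ofReal]; exact integral_congr_ae (ae_of_all _ fun t ↦ by push_cast; ring)
    rw [weilPoleForm, hC', hS', Complex.norm_real, Complex.norm_real, Real.norm_eq_abs, Real.norm_eq_abs, sq_abs, sq_abs]
  have hnorm : (∫ x, ‖((g x : ℂ))‖ ^ 2) = ∫ x, g x ^ 2 :=
    integral_congr_ae (ae_of_all _ fun x ↦ by simp only [Complex.norm_real, Real.norm_eq_abs, sq_abs])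
  -- increments are the real increments
  have hinc : ∀ t, weilIncrement (fun x ↦ (g x : ℂ)) t = ∫ x, (g (x + t) - g x) ^ 2 := fun t ↦ by
    unfold weilIncrement
    exact integral_congr_ae (Eventually.of_forall fun x ↦ by
      simp only [← Complex.ofReal_sub, Complex.norm_real, Real.norm_eq_abs, sq_abs])
  have hincQ : ∀ t, ∫ x, (g (x + t) - g x) ^ 2 = 2 * (∫ x, g x ^ 2) - 2 * ∫ x, g (x - t) * g x := by
    intro t
    have i1 := integrable_shiftAdd_mul_shiftAdd hum hCu hus0 t t
    have i2 := integrable_shiftAdd_mul_shiftAdd hum hCu hus0 t 0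
    have i3 := integrable_shiftAdd_mul_shiftAdd hum hCu hus0 0 0
    simp only [add_zero] at i2 i3
    have hsq : ∀ y, g y * g y = g y ^ 2 := fun y ↦ by ring
    have e1 : ∫ x, g (x + t) * g (x + t) = ∫ x, g x ^ 2 := by
      rw [integral_add_right_eq_self (fun y ↦ g y * g y) t]; simp_rw [hsq]
    have e2 : ∫ x, g (x + t) * g x = ∫ x, g (x - t) * g x := by
      rw [← integral_add_right_eq_self (fun y ↦ g (y + t) * g y) (-t)]
      refine integral_congr_ae (Eventually.of_forall fun x ↦ ?_)
      show g (x + -t + t) * g (x + -t) = g (x - t) * g x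
      rw [neg_add_cancel_right, ← sub_eq_add_neg, mul_comm]
    have e3 : ∫ x, g x * g x = ∫ x, g x ^ 2 := by simp_rw [hsq]
    have e : ∀ x, (g (x + t) - g x) ^ 2 = g (x + t) * g (x + t) - 2 * (g (x + t) * g x) + g x * g x := fun x ↦ by ring
    simp_rw [e]
    rw [integral_add (f := fun x ↦ g (x + t) * g (x + t) - 2 * (g (x + t) * g x)) (g := fun x ↦ g x * g x)
        (i1.sub (i2.const_mul 2)) i3,
      integral_sub (f := fun x ↦ g (x + t) * g (x + t)) (g := fun x ↦ 2 * (g (x + t) * g x)) i1 (i2.const_mul 2),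
      integral_const_mul, e1, e2, e3]
    ring
  have hQ : primeShiftForm b g = 2 * (∫ x, g x ^ 2) * (∑ n ∈ weilPrimeIndex b, (Λ n : ℝ) / Real.sqrt n)
      - ∑ n ∈ weilPrimeIndex b, (Λ n : ℝ) / Real.sqrt n * weilIncrement (fun x ↦ (g x : ℂ)) (Real.log n) := by
    unfold primeShiftForm
    rw [Finset.mul_sum, ← Finset.sum_sub_distrib]
    refine Finset.sum_congr rfl fun n _ ↦ ?_
    rw [hinc, hincQ]; ring
  have harch : (∫ t in Ioi (0 : ℝ), weilArchDensity t * weilIncrement (fun x ↦ (g x : ℂ)) t)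
      = ∫ t in Ioi (0 : ℝ), weilArchDensity t * ∫ x, (g (x + t) - g x) ^ 2 :=
    setIntegral_congr_fun measurableSet_Ioi fun t _ ↦ by simp only [hinc]
  unfold weilDirichletEnergy weilMarkovConstant at hre
  rw [hpole, hnorm, harch] at hre
  set N := ∫ x, g x ^ 2
  set E := ∑ n ∈ weilPrimeIndex b, (Λ n : ℝ) / Real.sqrt n * weilIncrement (fun x ↦ (g x : ℂ)) (Real.log n)
  set W := ∑ n ∈ weilPrimeIndex b, (Λ n : ℝ) / Real.sqrt n
  linear_combination (-1 : ℝ) * hre + hQ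

/-! ## §2 The zero energy is a quadratic form -/

/-- The complexification of `c·f + r` is `c·F + R`. -/
theorem ofReal_smul_add (f r : ℝ → ℝ) (c : ℝ) :
    (fun x ↦ ((c * f x + r x : ℝ) : ℂ)) = (fun x ↦ (c : ℂ) * (f x : ℂ)) + fun x ↦ (r x : ℂ) := by
  funext x; simp only [Pi.add_apply]; push_cast; ring

/-- A real Weil test's complexification is continuous with compact support; `c·f + r` is again a real Weil test. -/
theorem isWeilTest_smul_add {f r : ℝ → ℝ} (hf : IsWeilTest fun x ↦ (f x : ℂ)) (hr : IsWeilTest fun x ↦ (r x : ℂ)) (c : ℝ) :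
    IsWeilTest fun x ↦ ((c * f x + r x : ℝ) : ℂ) := by
  rw [ofReal_smul_add]; exact (hf.const_mul (c : ℂ)).add hr

/-- The Mellin transform of `c·f + r` on the critical line: `c·f̂ + r̂`. -/
theorem weilMellin_smul_add {f r : ℝ → ℝ} (hf : IsWeilTest fun x ↦ (f x : ℂ)) (hr : IsWeilTest fun x ↦ (r x : ℂ))
    (c : ℝ) (s : ℂ) :
    weilMellin (fun x ↦ ((c * f x + r x : ℝ) : ℂ)) s
      = (c : ℂ) * weilMellin (fun x ↦ (f x : ℂ)) s + weilMellin (fun x ↦ (r x : ℂ)) s := by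
  have hcf : IsWeilTest fun x ↦ (c : ℂ) * (f x : ℂ) := hf.const_mul (c : ℂ)
  rw [ofReal_smul_add, weilMellin_add hcf.1.continuous hcf.2 hr.1.continuous hr.2, weilMellin_const_mul]

/-- `‖cA + B‖² = c²‖A‖² + 2c·Re(A·conj B) + ‖B‖²` for real `c`. -/
theorem norm_sq_smul_add (A B : ℂ) (c : ℝ) :
    ‖(c : ℂ) * A + B‖ ^ 2 = c ^ 2 * ‖A‖ ^ 2 + 2 * c * (A * (starRingEnd ℂ) B).re + ‖B‖ ^ 2 := by
  rw [Complex.sq_norm, Complex.sq_norm, Complex.sq_norm, Complex.normSq_add, Complex.normSq_mul, Complex.normSq_ofReal]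
  have : ((c : ℂ) * A * (starRingEnd ℂ) B).re = c * (A * (starRingEnd ℂ) B).re := by
    rw [mul_assoc, Complex.re_ofReal_mul]
  rw [this]; ring

/-- Squares of a linear combination under an integral: `∫‖cF + R‖² = c²∫‖F‖² + 2c∫Re(F·conj R) + ∫‖R‖²` (real `c`), for square-integrable
continuous `F, R`. -/
theorem integral_norm_sq_smul_add {ν : Measure ℝ} {F R : ℝ → ℂ} (hFc : Continuous F) (hRc : Continuous R)
    (hIf : Integrable (fun t ↦ ‖F t‖ ^ 2) ν) (hIr : Integrable (fun t ↦ ‖R t‖ ^ 2) ν) (c : ℝ) :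
    Integrable (fun t ↦ (F t * (starRingEnd ℂ) (R t)).re) ν ∧
      ∫ t, ‖(c : ℂ) * F t + R t‖ ^ 2 ∂ν
        = c ^ 2 * (∫ t, ‖F t‖ ^ 2 ∂ν) + 2 * c * (∫ t, (F t * (starRingEnd ℂ) (R t)).re ∂ν) + ∫ t, ‖R t‖ ^ 2 ∂ν := by
  have hXm : AEStronglyMeasurable (fun t ↦ (F t * (starRingEnd ℂ) (R t)).re) ν :=
    (Complex.continuous_re.comp (hFc.mul (Complex.continuous_conj.comp hRc))).aestronglyMeasurable
  have hIX : Integrable (fun t ↦ (F t * (starRingEnd ℂ) (R t)).re) ν := by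
    refine Integrable.mono' ((hIf.add hIr).div_const 2) hXm (Eventually.of_forall fun t ↦ ?_)
    rw [Real.norm_eq_abs]
    have h1 : |(F t * (starRingEnd ℂ) (R t)).re| ≤ ‖F t * (starRingEnd ℂ) (R t)‖ := Complex.abs_re_le_norm _
    rw [norm_mul, Complex.norm_conj] at h1
    have h2 : ‖F t‖ * ‖R t‖ ≤ (‖F t‖ ^ 2 + ‖R t‖ ^ 2) / 2 := by nlinarith only [sq_nonneg (‖F t‖ - ‖R t‖)]
    exact h1.trans h2
  refine ⟨hIX, ?_⟩
  simp_rw [norm_sq_smul_add]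
  rw [integral_add (f := fun t ↦ c ^ 2 * ‖F t‖ ^ 2 + 2 * c * (F t * (starRingEnd ℂ) (R t)).re) (g := fun t ↦ ‖R t‖ ^ 2)
      ((hIf.const_mul _).add (hIX.const_mul _)) hIr,
    integral_add (f := fun t ↦ c ^ 2 * ‖F t‖ ^ 2) (g := fun t ↦ 2 * c * (F t * (starRingEnd ℂ) (R t)).re)
      (hIf.const_mul _) (hIX.const_mul _),
    integral_const_mul, integral_const_mul]

/-- **`Z(c·f + r) = c²Z(f) + 2c·X(f,r) + Z(r)`** under RH (integrability of the energies from the Bochner form), with the cross energy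
`X(f,r) = ∫ Re(f̂(½+it)·conj r̂(½+it)) dν`. -/
theorem zeroEnergy_smul_add (hRH : RiemannHypothesis) {f r : ℝ → ℝ} (hf : IsWeilTest fun x ↦ (f x : ℂ))
    (hr : IsWeilTest fun x ↦ (r x : ℂ)) (c : ℝ) :
    ∫ t : ℝ, ‖weilMellin (fun x ↦ ((c * f x + r x : ℝ) : ℂ)) (1 / 2 + t * I)‖ ^ 2 ∂WeilBochner.zetaZeroHeightMeasure
      = c ^ 2 * (∫ t : ℝ, ‖weilMellin (fun x ↦ (f x : ℂ)) (1 / 2 + t * I)‖ ^ 2 ∂WeilBochner.zetaZeroHeightMeasure)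
        + 2 * c * (∫ t : ℝ, (weilMellin (fun x ↦ (f x : ℂ)) (1 / 2 + t * I)
            * (starRingEnd ℂ) (weilMellin (fun x ↦ (r x : ℂ)) (1 / 2 + t * I))).re ∂WeilBochner.zetaZeroHeightMeasure)
        + ∫ t : ℝ, ‖weilMellin (fun x ↦ (r x : ℂ)) (1 / 2 + t * I)‖ ^ 2 ∂WeilBochner.zetaZeroHeightMeasure := by
  have hIf := (WeilBochner.weilQuadratic_eq_integral_of_riemannHypothesis hRH hf).1
  have hIr := (WeilBochner.weilQuadratic_eq_integral_of_riemannHypothesis hRH hr).1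
  have hline : Continuous fun t : ℝ ↦ (1 / 2 : ℂ) + t * I := by fun_prop
  have hFc : Continuous fun t : ℝ ↦ weilMellin (fun x ↦ (f x : ℂ)) (1 / 2 + t * I) :=
    (continuous_weilMellin hf.1.continuous hf.2).comp hline
  have hRc : Continuous fun t : ℝ ↦ weilMellin (fun x ↦ (r x : ℂ)) (1 / 2 + t * I) :=
    (continuous_weilMellin hr.1.continuous hr.2).comp hline
  have hpt : (fun t : ℝ ↦ ‖weilMellin (fun x ↦ ((c * f x + r x : ℝ) : ℂ)) (1 / 2 + (t : ℂ) * I)‖ ^ 2)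
      = fun t : ℝ ↦ ‖(c : ℂ) * weilMellin (fun x ↦ (f x : ℂ)) (1 / 2 + (t : ℂ) * I)
          + weilMellin (fun x ↦ (r x : ℂ)) (1 / 2 + (t : ℂ) * I)‖ ^ 2 := by
    funext t; rw [weilMellin_smul_add hf hr]
  rw [hpt]
  exact (integral_norm_sq_smul_add hFc hRc hIf hIr c).2

/-- **Polarization**: `Z(f + r) − Z(f − r) = 4X(f, r)`. -/
theorem zeroEnergy_add_sub_zeroEnergy_sub (hRH : RiemannHypothesis) {f r : ℝ → ℝ} (hf : IsWeilTest fun x ↦ (f x : ℂ))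
    (hr : IsWeilTest fun x ↦ (r x : ℂ)) :
    (∫ t : ℝ, ‖weilMellin (fun x ↦ ((f x + r x : ℝ) : ℂ)) (1 / 2 + t * I)‖ ^ 2 ∂WeilBochner.zetaZeroHeightMeasure)
        - ∫ t : ℝ, ‖weilMellin (fun x ↦ ((f x - r x : ℝ) : ℂ)) (1 / 2 + t * I)‖ ^ 2 ∂WeilBochner.zetaZeroHeightMeasure
      = 4 * ∫ t : ℝ, (weilMellin (fun x ↦ (r x : ℂ)) (1 / 2 + t * I)
            * (starRingEnd ℂ) (weilMellin (fun x ↦ (f x : ℂ)) (1 / 2 + t * I))).re ∂WeilBochner.zetaZeroHeightMeasure := by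
  have h1 := zeroEnergy_smul_add hRH hr hf 1
  have h2 := zeroEnergy_smul_add hRH hr hf (-1)
  have e1 : (fun x ↦ ((f x + r x : ℝ) : ℂ)) = fun x ↦ ((1 * r x + f x : ℝ) : ℂ) := by funext x; push_cast; ring
  have e2 : (fun x ↦ ((f x - r x : ℝ) : ℂ)) = fun x ↦ (((-1) * r x + f x : ℝ) : ℂ) := by funext x; push_cast; ring
  rw [e1, e2, h1, h2]; ring

/-- The zero energy is nonnegative. -/
theorem zeroEnergy_nonneg (g : ℝ → ℝ) :
    0 ≤ ∫ t : ℝ, ‖weilMellin (fun x ↦ (g x : ℂ)) (1 / 2 + t * I)‖ ^ 2 ∂WeilBochner.zetaZeroHeightMeasure :=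
  integral_nonneg fun t ↦ by positivity

/-- **The zero energy along a decomposition keeps the profile's share**: under RH, for real Weil tests `f, r` and real `c`,
`Z(c·f + r) ≥ c²Z(f) + (c/2)·(Z(f + r) − Z(f − r))` (`= c²Z(f) + 2cX(f,r)`, dropping `Z(r) ≥ 0`). -/
theorem zeroEnergy_smul_add_ge (hRH : RiemannHypothesis) {f r : ℝ → ℝ} (hf : IsWeilTest fun x ↦ (f x : ℂ))
    (hr : IsWeilTest fun x ↦ (r x : ℂ)) (c : ℝ) :
    c ^ 2 * (∫ t : ℝ, ‖weilMellin (fun x ↦ (f x : ℂ)) (1 / 2 + t * I)‖ ^ 2 ∂WeilBochner.zetaZeroHeightMeasure)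
        + c / 2 * ((∫ t : ℝ, ‖weilMellin (fun x ↦ ((f x + r x : ℝ) : ℂ)) (1 / 2 + t * I)‖ ^ 2 ∂WeilBochner.zetaZeroHeightMeasure)
          - ∫ t : ℝ, ‖weilMellin (fun x ↦ ((f x - r x : ℝ) : ℂ)) (1 / 2 + t * I)‖ ^ 2 ∂WeilBochner.zetaZeroHeightMeasure)
      ≤ ∫ t : ℝ, ‖weilMellin (fun x ↦ ((c * f x + r x : ℝ) : ℂ)) (1 / 2 + t * I)‖ ^ 2 ∂WeilBochner.zetaZeroHeightMeasure := by
  rw [zeroEnergy_smul_add hRH hf hr c, zeroEnergy_add_sub_zeroEnergy_sub hRH hf hr]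
  -- the two cross energies agree: `Re(F conj R) = Re(R conj F)`
  have hsym : (∫ t : ℝ, (weilMellin (fun x ↦ (r x : ℂ)) (1 / 2 + t * I)
        * (starRingEnd ℂ) (weilMellin (fun x ↦ (f x : ℂ)) (1 / 2 + t * I))).re ∂WeilBochner.zetaZeroHeightMeasure)
      = ∫ t : ℝ, (weilMellin (fun x ↦ (f x : ℂ)) (1 / 2 + t * I)
        * (starRingEnd ℂ) (weilMellin (fun x ↦ (r x : ℂ)) (1 / 2 + t * I))).re ∂WeilBochner.zetaZeroHeightMeasure := by
    refine integral_congr_ae (Eventually.of_forall fun t ↦ ?_)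
    set A := weilMellin (fun x ↦ (f x : ℂ)) (1 / 2 + t * I)
    set B := weilMellin (fun x ↦ (r x : ℂ)) (1 / 2 + t * I)
    show (B * (starRingEnd ℂ) A).re = (A * (starRingEnd ℂ) B).re
    rw [← Complex.conj_re (B * (starRingEnd ℂ) A), map_mul, Complex.conj_conj, mul_comm]
  rw [hsym]
  have h0 := zeroEnergy_nonneg r
  nlinarith only [h0]

end FloorCoshSplit

end Summit.RiemannHypothesis.RiemannHypothesis.Theorems.WeilFormatC
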